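import Literature.NumberTheory.EllipticCurves.WeierstrassPDivisionValues
import Literature.NumberTheory.EllipticCurves.WeierstrassZetaLegendre
import HarnessLib

/-!
# `ζ`-division values: the weight-`1` vector-valued modular forms
# `Z_v(τ) = ζ((c_v τ + d_v)/N; τ) - ((c_v τ + d_v)/N) G₂(τ) + 2πi c_v/N`

Topic `Literature/NumberTheory/EllipticCurves`; namespace
`Literature.NumberTheory.EllipticCurves.ModularForms`.  Definitions with bodies (`divPoint`,
`zetaDivSummand`, `weierstrassZetaDiv`, `eisensteinOneDiv`, `eisensteinOneDivChar`) and theorems;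
no named fact.

For `τ ∈ ℍ`, `Λ_τ = ℤτ + ℤ`, `N ≥ 1` and `v = (c_v, d_v) ∈ ℤ²` put `z_v = (c_v τ + d_v)/N`
(`divPoint`).  The Weierstrass zeta function `ζ(z; Λ_τ) = ∑_{l ∈ Λ_τ} (1/(z-l) + 1/l + z/l²)`
(tree: `PeriodPair.weierstrassZeta`, an absolutely convergent lattice sum) is not elliptic, but its
quasi-periods are `η(1) = G₂(τ)`, `η(τ) = τ G₂(τ) - 2πi` (Eisenstein; tree:
`PeriodPair.weierstrassZeta_add_fst_sub`, `…_snd_sub`, with Mathlib's quasimodular `G₂ = G2`), so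
that the **`ζ`-division value corrected by `G₂`**

  `Z_v(τ) = ζ(z_v; Λ_τ) - z_v G₂(τ) + 2πi c_v/N`                          (`eisensteinOneDiv`)

depends only on `v mod N` (`eisensteinOneDiv_add_nsmul`) and — because the defect
`G₂(γτ) = (cτ+d)² G₂(τ) - 2πi c (cτ+d)` of `G₂` is exactly compensated by the term `2πi c_v/N` —
satisfies the EXACT transformation law of a vector-valued modular form of weight `1`:

* `eisensteinOneDiv_slash` — **`Z_v ∣₁ γ = Z_{vγ}` for all `γ ∈ SL₂(ℤ)`** (the lattice sum
  `ζ(z_v; Λ_τ)` is written over `x ∈ ℤ²` with Mathlib's `eisSummand`, `weierstrassZetaDiv`, and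
  transformed termwise by `EisensteinSeries.eisSummand_SL2_apply`; `G₂` by Mathlib's
  `EisensteinSeries.G2_slash_action`);
* `eisensteinOneDiv_add_nsmul`, `eisensteinOneDiv_congr_mod` — `Z_{v + Nw} = Z_v`;
  `eisensteinOneDiv_neg` — `Z_{-v} = -Z_v`;
* `eisensteinOneDivChar_slash_of_mem_gamma0` — for a Dirichlet character `χ` mod `N` the
  combination `T_χ = ∑_{e mod N} χ̄(e) Z_{(0,e)}` satisfies `T_χ ∣₁ γ = χ(d) T_χ` on `Γ₀(N)`.

This is the weight-`1` companion of the `℘`-division values `f_v = ℘(z_v; Λ_τ)`,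
`f_v ∣₂ γ = f_{vγ}` (`WeierstrassPDivisionValues`), i.e. the classical construction of the
Eisenstein series of weight `1` on `Γ(N)` from the Weierstrass zeta function at division points
(Hecke 1926/1927: the "Teilwerte" of `ζ(z) - η z`; Schoeneberg, *Elliptic Modular Functions*,
Ch. VII §§1–3 and Ch. VIII ("division values"); Lang, *Elliptic Functions*, Ch. 18–19 (Klein forms
and the forms `g_a`); Kato, *`p`-adic Hodge theory and values of zeta functions of modular forms*,
Astérisque 295 (2004), §3 (the Eisenstein series `E_1` via `ζ - η`); Diamond–Shurman §4.8 for the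
resulting series `G_1^v`).  Only exact lattice manipulations are used: no conditionally
convergent series and no Hecke limit `s → 0`.  The expansion of `Z_v` at `i∞` (constant term
`2πi B₁(c_v/N)` for `N ∤ c_v`, `π cot(π d_v/N)` for `N ∣ c_v`) and the two-character weight-one
Eisenstein series assembled from the `Z_v` are the next files.

## References

* E. Hecke, *Theorie der Eisensteinschen Reihen höherer Stufe und ihre Anwendung auf
  Funktionentheorie und Arithmetik*, Abh. Math. Sem. Hamburg 5 (1927), 199–224, §§1–2.
* B. Schoeneberg, *Elliptic Modular Functions*, Springer (1974), Ch. VII–VIII.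
* S. Lang, *Elliptic Functions*, 2nd ed., GTM 112, Springer (1987), Ch. 18 §§1–2.
* F. Diamond, J. Shurman, *A First Course in Modular Forms*, GTM 228 (2005), §1.5, §4.8.
  [DiamondShurman2005]
-/

noncomputable section

open UpperHalfPlane hiding I
open EisensteinSeries ModularForm CongruenceSubgroup Matrix PeriodPair Complex

open scoped MatrixGroups Real

namespace Literature.NumberTheory.EllipticCurves.ModularForms

/-! ### The division point `z_v = (c_v τ + d_v)/N` -/

/-- The `N`-division point `z_v(τ) = (c_v τ + d_v)/N` of `ℂ/Λ_τ`, `v = (c_v, d_v)`. [folklore] -/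
def divPoint (N : ℕ) (v : Fin 2 → ℤ) (τ : ℍ) : ℂ := ((v 0 : ℂ) * τ + v 1) / N

variable {N : ℕ}

/-- `z_{v + Nw} = z_v + (w₀ τ + w₁)`. [folklore] -/
theorem divPoint_add_nsmul (hN : N ≠ 0) (v w : Fin 2 → ℤ) (τ : ℍ) :
    divPoint N (v + (N : ℤ) • w) τ = divPoint N v τ + ((w 0 : ℂ) * τ + w 1) := by
  have hN' : (N : ℂ) ≠ 0 := by exact_mod_cast hN
  have h0 : ((v + (N : ℤ) • w) 0 : ℤ) = v 0 + N * w 0 := by simp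
  have h1 : ((v + (N : ℤ) • w) 1 : ℤ) = v 1 + N * w 1 := by simp
  unfold divPoint
  rw [h0, h1]
  push_cast
  field_simp
  ring

/-- `z_{-v} = -z_v`. [folklore] -/
theorem divPoint_neg (v : Fin 2 → ℤ) (τ : ℍ) : divPoint N (-v) τ = -divPoint N v τ := by
  unfold divPoint
  simp only [Pi.neg_apply, Int.cast_neg]
  ring

/-- **`z_v(γτ) = z_{vγ}(τ)/(cτ + d)`** for `γ ∈ SL₂(ℤ)`. [folklore] -/
theorem divPoint_smul (N : ℕ) (v : Fin 2 → ℤ) (γ : SL(2, ℤ)) (τ : ℍ) :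
    divPoint N v (γ • τ) = divPoint N (v ᵥ* (γ : Matrix (Fin 2) (Fin 2) ℤ)) τ / denom γ τ := by
  have h := eisSummand_SL2_apply (-1) v γ τ
  simp only [eisSummand, neg_neg, zpow_one] at h
  unfold divPoint
  rw [h, _root_.zpow_neg_one, inv_mul_eq_div, div_right_comm]

/-! ### The lattice sum `ζ(z_v; Λ_τ)` -/

/-- The summand `1/(z_v - l) + 1/l + z_v/l²` of `ζ(z_v; Λ_τ)` at the lattice point `l = x₀τ + x₁`,
written with Mathlib's `eisSummand` (`1/(z_v - l) = N/((c_v - Nx₀)τ + (d_v - Nx₁))`; conventions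
`1/0 = 0`). [folklore] -/
def zetaDivSummand (N : ℕ) (v : Fin 2 → ℤ) (τ : ℍ) (x : Fin 2 → ℤ) : ℂ :=
  (N : ℂ) * eisSummand 1 (v - (N : ℤ) • x) τ + eisSummand 1 x τ +
    divPoint N v τ * eisSummand 2 x τ

/-- **The `ζ`-division value** `ζ(z_v; Λ_τ)` as the absolutely convergent lattice sum
`∑_{x ∈ ℤ²} (1/(z_v - x₀τ - x₁) + 1/(x₀τ + x₁) + z_v/(x₀τ + x₁)²)` (see
`weierstrassZetaDiv_eq_weierstrassZeta`). [cite: DiamondShurman2005, §4.8] -/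
def weierstrassZetaDiv (N : ℕ) (v : Fin 2 → ℤ) (τ : ℍ) : ℂ :=
  ∑' x : Fin 2 → ℤ, zetaDivSummand N v τ x

/-- **The corrected `ζ`-division value** `Z_v(τ) = ζ(z_v; Λ_τ) - z_v G₂(τ) + 2πi c_v/N`, the
weight-`1` Eisenstein series of level `Γ(N)` attached to `v ∈ ℤ²` (Hecke's "Teilwert" of
`ζ(z) - η z`). [cite: DiamondShurman2005, §4.8] -/
def eisensteinOneDiv (N : ℕ) (v : Fin 2 → ℤ) (τ : ℍ) : ℂ :=
  weierstrassZetaDiv N v τ - divPoint N v τ * G2 τ + 2 * π * I * (v 0 : ℂ) / N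

/-- The summand is `1/(z_v - l) + 1/l + z_v/l²`, `l = x₀ τ + x₁`. [folklore] -/
theorem zetaDivSummand_eq (hN : N ≠ 0) (v x : Fin 2 → ℤ) (τ : ℍ) :
    zetaDivSummand N v τ x =
      1 / (divPoint N v τ - ((x 0 : ℂ) * τ + x 1)) + 1 / ((x 0 : ℂ) * τ + x 1) +
        divPoint N v τ / ((x 0 : ℂ) * τ + x 1) ^ 2 := by
  have hN' : (N : ℂ) ≠ 0 := by exact_mod_cast hN
  have h0 : ((v - (N : ℤ) • x) 0 : ℤ) = v 0 - N * x 0 := by simp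
  have h1 : ((v - (N : ℤ) • x) 1 : ℤ) = v 1 - N * x 1 := by simp
  have h : divPoint N v τ - ((x 0 : ℂ) * τ + x 1) =
      (((v 0 : ℂ) - N * x 0) * τ + ((v 1 : ℂ) - N * x 1)) / N := by
    unfold divPoint
    field_simp
    ring
  rw [h]
  simp only [zetaDivSummand, eisSummand, h0, h1, Int.cast_sub, Int.cast_mul, Int.cast_natCast,
    _root_.zpow_neg, zpow_one, one_div, inv_div]
  rw [div_eq_mul_inv (N : ℂ), div_eq_mul_inv (divPoint N v τ)]
  norm_cast

/-- **`weierstrassZetaDiv N v τ = ζ(z_v; Λ_τ)`**: the lattice sum is the Weierstrass zeta function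
of the period pair `(τ, 1)` (tree: `PeriodPair.weierstrassZeta`, `hasSum_weierstrassZeta_holds`).
[cite: DiamondShurman2005, §4.8] -/
theorem hasSum_zetaDivSummand (hN : N ≠ 0) (v : Fin 2 → ℤ) (τ : ℍ) :
    HasSum (zetaDivSummand N v τ)
      ((periodPairOfUpperHalfPlane τ).weierstrassZeta (divPoint N v τ)) := by
  set L := periodPairOfUpperHalfPlane τ with hL
  set e : (Fin 2 → ℤ) ≃ L.lattice := L.latticeBasis.equivFun.symm.toEquiv with he
  have hcoe : ∀ x : Fin 2 → ℤ, ((e x : L.lattice) : ℂ) = (x 0 : ℂ) * τ + x 1 := by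
    intro x
    rw [he, LinearEquiv.coe_toEquiv, Module.Basis.equivFun_symm_apply, Fin.sum_univ_two,
      Submodule.coe_add, Submodule.coe_smul_of_tower, Submodule.coe_smul_of_tower,
      PeriodPair.latticeBasis_zero, PeriodPair.latticeBasis_one, hL, periodPairOfUpperHalfPlane_ω₁,
      periodPairOfUpperHalfPlane_ω₂, zsmul_eq_mul, zsmul_eq_mul, mul_one]
  have h := L.hasSum_weierstrassZeta_holds (divPoint N v τ)
  rw [← e.hasSum_iff] at h
  convert h using 1
  funext x
  rw [Function.comp_apply, hcoe x, zetaDivSummand_eq hN, sq]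

/-- `ζ(z_v; Λ_τ)` as a value of `PeriodPair.weierstrassZeta`. [cite: DiamondShurman2005, §4.8] -/
theorem weierstrassZetaDiv_eq_weierstrassZeta (hN : N ≠ 0) (v : Fin 2 → ℤ) (τ : ℍ) :
    weierstrassZetaDiv N v τ =
      (periodPairOfUpperHalfPlane τ).weierstrassZeta (divPoint N v τ) :=
  (hasSum_zetaDivSummand hN v τ).tsum_eq

/-- The lattice sum is summable. [folklore] -/
theorem summable_zetaDivSummand (hN : N ≠ 0) (v : Fin 2 → ℤ) (τ : ℍ) :
    Summable (zetaDivSummand N v τ) :=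
  (hasSum_zetaDivSummand hN v τ).summable

/-! ### The quasi-periods of `Λ_τ`: `η(1) = G₂(τ)`, `η(τ) = τ G₂(τ) - 2πi` -/

/-- The point `τ/1` of `ℍ` is `τ`. [folklore] -/
private theorem mk_div_one (τ : ℍ) (h : 0 < ((τ : ℂ) / (1 : ℂ)).im) :
    (⟨(τ : ℂ) / 1, h⟩ : ℍ) = τ := UpperHalfPlane.ext (by simp)

/-- **`ζ(z + 1; Λ_τ) = ζ(z; Λ_τ) + G₂(τ)`** for every `z` (Eisenstein's formula for the quasi-period
of the basis vector `1` of the oriented basis `(1, τ)`). [folklore] -/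
theorem weierstrassZeta_add_one_eq (τ : ℍ) (z : ℂ) :
    (periodPairOfUpperHalfPlane τ).weierstrassZeta (z + 1) =
      (periodPairOfUpperHalfPlane τ).weierstrassZeta z + G2 τ := by
  set L := periodPairOfUpperHalfPlane τ with hL
  have h : 0 < (L.ω₁ / L.ω₂).im := by
    rw [hL, periodPairOfUpperHalfPlane_ω₁, periodPairOfUpperHalfPlane_ω₂, div_one]
    exact τ.im_pos
  have key := weierstrassZeta_add_fst_sub _ L.coe_prodComm_latticeEquivProd_symm h z
  have hω₂ : L.ω₂ = 1 := rfl
  have hτ : (⟨L.ω₁ / L.ω₂, h⟩ : ℍ) = τ := UpperHalfPlane.ext (by simp [hL])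
  rw [hτ, hω₂, div_one] at key
  linear_combination key

/-- **`ζ(z + τ; Λ_τ) = ζ(z; Λ_τ) + τ G₂(τ) - 2πi`** for every `z` (Eisenstein's formula for the
second basis vector; the `-2πi` is Legendre's relation). [folklore] -/
theorem weierstrassZeta_add_tau_eq (τ : ℍ) (z : ℂ) :
    (periodPairOfUpperHalfPlane τ).weierstrassZeta (z + τ) =
      (periodPairOfUpperHalfPlane τ).weierstrassZeta z + ((τ : ℂ) * G2 τ - 2 * π * I) := by
  set L := periodPairOfUpperHalfPlane τ with hL
  have h : 0 < (L.ω₁ / L.ω₂).im := by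
    rw [hL, periodPairOfUpperHalfPlane_ω₁, periodPairOfUpperHalfPlane_ω₂, div_one]
    exact τ.im_pos
  have key := weierstrassZeta_add_snd_sub _ L.coe_prodComm_latticeEquivProd_symm h z
  have hω₂ : L.ω₂ = 1 := rfl
  have hω₁ : L.ω₁ = τ := rfl
  have hτ : (⟨L.ω₁ / L.ω₂, h⟩ : ℍ) = τ := UpperHalfPlane.ext (by simp [hL])
  rw [hτ, hω₂, hω₁] at key
  linear_combination key

/-- `ζ(z + n; Λ_τ) = ζ(z; Λ_τ) + n G₂(τ)` for `n ∈ ℤ`. [folklore] -/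
theorem weierstrassZeta_add_intCast_eq (τ : ℍ) (z : ℂ) (n : ℤ) :
    (periodPairOfUpperHalfPlane τ).weierstrassZeta (z + n) =
      (periodPairOfUpperHalfPlane τ).weierstrassZeta z + n * G2 τ := by
  induction n using Int.induction_on generalizing z with
  | zero => simp
  | succ n ih =>
    have ih' := ih z
    have h := weierstrassZeta_add_one_eq τ (z + n)
    push_cast at ih' h ⊢
    rw [show z + ((n : ℂ) + 1) = z + n + 1 by ring, h, ih']
    ring
  | pred n ih =>
    have ih' := ih z
    have h := weierstrassZeta_add_one_eq τ (z + (-(n : ℂ) - 1))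
    push_cast at ih' h ⊢
    rw [show z + (-(n : ℂ) - 1) + 1 = z + -(n : ℂ) by ring, ih'] at h
    linear_combination -h

/-- `ζ(z + nτ; Λ_τ) = ζ(z; Λ_τ) + n (τ G₂(τ) - 2πi)` for `n ∈ ℤ`. [folklore] -/
theorem weierstrassZeta_add_intCast_mul_tau_eq (τ : ℍ) (z : ℂ) (n : ℤ) :
    (periodPairOfUpperHalfPlane τ).weierstrassZeta (z + n * τ) =
      (periodPairOfUpperHalfPlane τ).weierstrassZeta z + n * ((τ : ℂ) * G2 τ - 2 * π * I) := by
  induction n using Int.induction_on generalizing z with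
  | zero => simp
  | succ n ih =>
    have ih' := ih z
    have h := weierstrassZeta_add_tau_eq τ (z + n * τ)
    push_cast at ih' h ⊢
    rw [show z + ((n : ℂ) + 1) * τ = z + n * τ + τ by ring, h, ih']
    ring
  | pred n ih =>
    have ih' := ih z
    have h := weierstrassZeta_add_tau_eq τ (z + (-(n : ℂ) - 1) * τ)
    push_cast at ih' h ⊢
    rw [show z + (-(n : ℂ) - 1) * τ + τ = z + -(n : ℂ) * τ by ring, ih'] at h
    linear_combination -h

/-- `ζ(z + w₀τ + w₁; Λ_τ) = ζ(z; Λ_τ) + (w₀ τ + w₁) G₂(τ) - 2πi w₀`: the quasi-period of the lattice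
vector `w₀ τ + w₁`. [folklore] -/
theorem weierstrassZeta_add_lattice_eq (τ : ℍ) (z : ℂ) (w₀ w₁ : ℤ) :
    (periodPairOfUpperHalfPlane τ).weierstrassZeta (z + ((w₀ : ℂ) * τ + w₁)) =
      (periodPairOfUpperHalfPlane τ).weierstrassZeta z +
        (((w₀ : ℂ) * τ + w₁) * G2 τ - 2 * π * I * w₀) := by
  rw [show z + ((w₀ : ℂ) * τ + w₁) = z + w₀ * τ + w₁ by ring, weierstrassZeta_add_intCast_eq,
    weierstrassZeta_add_intCast_mul_tau_eq]
  ring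

/-! ### Periodicity in `v` and oddness -/

/-- `ζ(z_{v+Nw}) = ζ(z_v) + (w₀τ + w₁) G₂(τ) - 2πi w₀`. [folklore] -/
theorem weierstrassZetaDiv_add_nsmul (hN : N ≠ 0) (v w : Fin 2 → ℤ) (τ : ℍ) :
    weierstrassZetaDiv N (v + (N : ℤ) • w) τ =
      weierstrassZetaDiv N v τ + (((w 0 : ℂ) * τ + w 1) * G2 τ - 2 * π * I * w 0) := by
  rw [weierstrassZetaDiv_eq_weierstrassZeta hN, weierstrassZetaDiv_eq_weierstrassZeta hN,
    divPoint_add_nsmul hN, weierstrassZeta_add_lattice_eq]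

/-- **`Z_{v + Nw} = Z_v`**: the corrected division value only depends on `v mod N` (the
quasi-period `(w₀τ + w₁)G₂ - 2πi w₀` of `ζ` cancels against `-z G₂ + 2πi c/N`).
[cite: DiamondShurman2005, §4.8] -/
theorem eisensteinOneDiv_add_nsmul (hN : N ≠ 0) (v w : Fin 2 → ℤ) (τ : ℍ) :
    eisensteinOneDiv N (v + (N : ℤ) • w) τ = eisensteinOneDiv N v τ := by
  have hN' : (N : ℂ) ≠ 0 := by exact_mod_cast hN
  have h0 : ((v + (N : ℤ) • w) 0 : ℤ) = v 0 + N * w 0 := by simp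
  unfold eisensteinOneDiv
  rw [weierstrassZetaDiv_add_nsmul hN, divPoint_add_nsmul hN, h0]
  push_cast
  field_simp
  ring

/-- `Z_v` only depends on `v mod N`. [cite: DiamondShurman2005, §4.8] -/
theorem eisensteinOneDiv_congr_mod (hN : N ≠ 0) {v v' : Fin 2 → ℤ}
    (h : ∀ i, (v i : ZMod N) = (v' i : ZMod N)) (τ : ℍ) :
    eisensteinOneDiv N v τ = eisensteinOneDiv N v' τ := by
  have hw : ∀ i, ∃ w : ℤ, v' i = v i + N * w := fun i ↦ by
    obtain ⟨w, hw⟩ := (ZMod.intCast_eq_intCast_iff_dvd_sub (v i) (v' i) N).1 (h i)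
    exact ⟨w, by linarith⟩
  choose w hw using hw
  have : v' = v + (N : ℤ) • (fun i ↦ w i) := by
    funext i
    rw [Pi.add_apply, Pi.smul_apply, smul_eq_mul]
    exact hw i
  rw [this, eisensteinOneDiv_add_nsmul hN]

/-- `ζ(z_{-v}) = -ζ(z_v)` (`ζ` is odd). [folklore] -/
theorem weierstrassZetaDiv_neg (hN : N ≠ 0) (v : Fin 2 → ℤ) (τ : ℍ) :
    weierstrassZetaDiv N (-v) τ = -weierstrassZetaDiv N v τ := by
  rw [weierstrassZetaDiv_eq_weierstrassZeta hN, weierstrassZetaDiv_eq_weierstrassZeta hN,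
    divPoint_neg, PeriodPair.weierstrassZeta_neg]

/-- **`Z_{-v} = -Z_v`.** [folklore] -/
theorem eisensteinOneDiv_neg (hN : N ≠ 0) (v : Fin 2 → ℤ) (τ : ℍ) :
    eisensteinOneDiv N (-v) τ = -eisensteinOneDiv N v τ := by
  unfold eisensteinOneDiv
  rw [weierstrassZetaDiv_neg hN, divPoint_neg]
  simp only [Pi.neg_apply, Int.cast_neg]
  ring

/-! ### The weight-`1` transformation law -/

/-- Right multiplication by `γ ∈ SL₂(ℤ)` is a permutation of `ℤ²`. [folklore] -/
private def vecMulPerm₁ (γ : SL(2, ℤ)) : (Fin 2 → ℤ) ≃ (Fin 2 → ℤ) where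
  toFun x := x ᵥ* (γ : Matrix (Fin 2) (Fin 2) ℤ)
  invFun x := x ᵥ* ((γ⁻¹ : SL(2, ℤ)) : Matrix (Fin 2) (Fin 2) ℤ)
  left_inv x := by
    simp only [Matrix.vecMul_vecMul, ← Matrix.SpecialLinearGroup.coe_mul, mul_inv_cancel,
      Matrix.SpecialLinearGroup.coe_one, Matrix.vecMul_one]
  right_inv x := by
    simp only [Matrix.vecMul_vecMul, ← Matrix.SpecialLinearGroup.coe_mul, inv_mul_cancel,
      Matrix.SpecialLinearGroup.coe_one, Matrix.vecMul_one]

/-- `vecMulPerm₁ γ x = x γ`. [folklore] -/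
@[simp] private theorem vecMulPerm₁_apply (γ : SL(2, ℤ)) (x : Fin 2 → ℤ) :
    vecMulPerm₁ γ x = x ᵥ* (γ : Matrix (Fin 2) (Fin 2) ℤ) := rfl

/-- The summand transforms with weight `1`: `s_v(γτ; x) = (cτ + d) s_{vγ}(τ; xγ)`. [folklore] -/
theorem zetaDivSummand_smul (N : ℕ) (v : Fin 2 → ℤ) (γ : SL(2, ℤ)) (τ : ℍ) (x : Fin 2 → ℤ) :
    zetaDivSummand N v (γ • τ) x =
      denom γ τ * zetaDivSummand N (v ᵥ* (γ : Matrix (Fin 2) (Fin 2) ℤ)) τ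
        (x ᵥ* (γ : Matrix (Fin 2) (Fin 2) ℤ)) := by
  have hD : denom γ τ ≠ 0 := denom_ne_zero γ τ
  unfold zetaDivSummand
  rw [eisSummand_SL2_apply, eisSummand_SL2_apply, eisSummand_SL2_apply, divPoint_smul,
    Matrix.sub_vecMul, Matrix.smul_vecMul]
  field_simp

/-- **`ζ(z_v(γτ); Λ_{γτ}) = (cτ + d) ζ(z_{vγ}(τ); Λ_τ)`**: the lattice sum transforms termwise and
`x ↦ xγ` permutes `ℤ²` (homogeneity of `ζ` of degree `-1`, `Λ_{γτ} = (cτ+d)⁻¹ Λ_τ`). [folklore] -/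
theorem weierstrassZetaDiv_smul (N : ℕ) (v : Fin 2 → ℤ) (γ : SL(2, ℤ)) (τ : ℍ) :
    weierstrassZetaDiv N v (γ • τ) =
      denom γ τ * weierstrassZetaDiv N (v ᵥ* (γ : Matrix (Fin 2) (Fin 2) ℤ)) τ := by
  unfold weierstrassZetaDiv
  simp_rw [zetaDivSummand_smul N v γ τ]
  rw [tsum_mul_left]
  congr 1
  exact (vecMulPerm₁ γ).tsum_eq (fun y ↦
    zetaDivSummand N (v ᵥ* (γ : Matrix (Fin 2) (Fin 2) ℤ)) τ y)

/-- **`G₂(γτ) = (cτ+d)² G₂(τ) - 2πi c (cτ+d)`** (Mathlib's `G2_slash_action`, unfolded). [folklore] -/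
theorem G2_smul_eq (γ : SL(2, ℤ)) (τ : ℍ) :
    G2 (γ • τ) = denom γ τ ^ 2 * G2 τ - 2 * π * I * (γ 1 0 : ℤ) * denom γ τ := by
  have hD : denom γ τ ≠ 0 := denom_ne_zero γ τ
  have h := congr_fun (G2_slash_action γ) τ
  rw [ModularForm.SL_slash_apply, Pi.sub_apply, D2] at h
  rw [_root_.zpow_neg, mul_inv_eq_iff_eq_mul₀ (zpow_ne_zero _ hD)] at h
  rw [h]
  field_simp

/-- **`Z_v(γτ) = (cτ + d) Z_{vγ}(τ)`** for `γ = (a b; c d) ∈ SL₂(ℤ)`: the defect of `G₂` contributes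
`2πi c z_{vγ}(τ)`, and `c z_{vγ}(τ) + c_v/N = (cτ + d)(vγ)₀/N` because `ad - bc = 1`.
[cite: DiamondShurman2005, §4.8 (the weight-1 Eisenstein series `G_1^v` are permuted by
`SL₂(ℤ)`)] -/
theorem eisensteinOneDiv_smul (N : ℕ) (v : Fin 2 → ℤ) (γ : SL(2, ℤ)) (τ : ℍ) :
    eisensteinOneDiv N v (γ • τ) =
      denom γ τ * eisensteinOneDiv N (v ᵥ* (γ : Matrix (Fin 2) (Fin 2) ℤ)) τ := by
  rcases Nat.eq_zero_or_pos N with hN | hN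
  · subst hN
    unfold eisensteinOneDiv divPoint
    rw [weierstrassZetaDiv_smul]
    simp
  have hN' : (N : ℂ) ≠ 0 := by exact_mod_cast hN.ne'
  have hD : denom γ τ ≠ 0 := denom_ne_zero γ τ
  have hdet : ((γ 0 0 : ℤ) : ℂ) * (γ 1 1 : ℤ) - (γ 0 1 : ℤ) * (γ 1 0 : ℤ) = 1 := by
    have := Matrix.SpecialLinearGroup.det_coe γ
    rw [Matrix.det_fin_two] at this
    exact_mod_cast this
  have hv0 : (((v ᵥ* (γ : Matrix (Fin 2) (Fin 2) ℤ)) 0 : ℤ) : ℂ) =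
      (v 0 : ℂ) * (γ 0 0 : ℤ) + (v 1 : ℂ) * (γ 1 0 : ℤ) := by
    simp [Matrix.vecMul, dotProduct, Fin.sum_univ_two]
  have hv1 : (((v ᵥ* (γ : Matrix (Fin 2) (Fin 2) ℤ)) 1 : ℤ) : ℂ) =
      (v 0 : ℂ) * (γ 0 1 : ℤ) + (v 1 : ℂ) * (γ 1 1 : ℤ) := by
    simp [Matrix.vecMul, dotProduct, Fin.sum_univ_two]
  have hden : denom γ τ = ((γ 1 0 : ℤ) : ℂ) * τ + ((γ 1 1 : ℤ) : ℂ) := by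
    simp [ModularGroup.denom_apply]
  -- the scalar identity `c z_{vγ} + c_v/N = (cτ + d)(vγ)₀/N` (uses `ad - bc = 1`)
  have hkey : 2 * π * I * ((γ 1 0 : ℤ) : ℂ) * divPoint N (v ᵥ* (γ : Matrix (Fin 2) (Fin 2) ℤ)) τ +
      2 * π * I * (v 0 : ℂ) / N =
      denom γ τ * (2 * π * I * (((v ᵥ* (γ : Matrix (Fin 2) (Fin 2) ℤ)) 0 : ℤ) : ℂ) / N) := by
    unfold divPoint
    rw [hv0, hv1, hden]
    linear_combination (-(2 * π * I * (v 0 : ℂ) / N)) * hdet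
  have h1 : divPoint N (v ᵥ* (γ : Matrix (Fin 2) (Fin 2) ℤ)) τ / denom γ τ *
      (denom γ τ ^ 2 * G2 τ - 2 * π * I * ((γ 1 0 : ℤ) : ℂ) * denom γ τ) =
      divPoint N (v ᵥ* (γ : Matrix (Fin 2) (Fin 2) ℤ)) τ * denom γ τ * G2 τ -
        2 * π * I * ((γ 1 0 : ℤ) : ℂ) * divPoint N (v ᵥ* (γ : Matrix (Fin 2) (Fin 2) ℤ)) τ := by
    field_simp
  unfold eisensteinOneDiv
  rw [weierstrassZetaDiv_smul, G2_smul_eq, divPoint_smul, h1]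
  linear_combination hkey

/-- **`Z_v ∣₁ γ = Z_{vγ}`** for every `γ ∈ SL₂(ℤ)`: the corrected `ζ`-division values form a
vector-valued modular form of weight `1` permuted by `SL₂(ℤ)` through its right action on
`ℤ² mod N`. [cite: DiamondShurman2005, §4.8] -/
theorem eisensteinOneDiv_slash (N : ℕ) (v : Fin 2 → ℤ) (γ : SL(2, ℤ)) :
    (eisensteinOneDiv N v) ∣[(1 : ℤ)] γ =
      eisensteinOneDiv N (v ᵥ* (γ : Matrix (Fin 2) (Fin 2) ℤ)) := by
  funext τ
  rw [ModularForm.SL_slash_apply, eisensteinOneDiv_smul, mul_comm, ← mul_assoc, ← zpow_add_one₀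
    (denom_ne_zero γ τ)]
  norm_num

/-! ### The character combination `T_χ = ∑_e χ̄(e) Z_{(0,e)}` -/

/-- **`T_χ(τ) = ∑_{e mod N} χ̄(e) Z_{(0,e)}(τ)`**, the `χ`-combination of the corrected `ζ`-values
at the real `N`-division points (a multiple of the weight-one Eisenstein series `E_1^{𝟙,χ}` for
`χ` odd; `0` for `χ` even). [cite: DiamondShurman2005, §4.8] -/
def eisensteinOneDivChar [NeZero N] (χ : DirichletCharacter ℂ N) (τ : ℍ) : ℂ :=
  ∑ e : ZMod N, χ⁻¹ e * eisensteinOneDiv N ![0, (e.val : ℤ)] τ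

/-- Entries of `w γ` for `w ∈ ℤ²`. [folklore] -/
private theorem vecMul_fin_two₁ (w : Fin 2 → ℤ) (A : Matrix (Fin 2) (Fin 2) ℤ) (j : Fin 2) :
    (w ᵥ* A) j = w 0 * A 0 j + w 1 * A 1 j := by
  simp [Matrix.vecMul, dotProduct, Fin.sum_univ_two]

/-- `(0, e) γ ≡ (0, e d) (mod N)` for `γ = (a b; c d) ∈ Γ₀(N)`, so `Z_{(0,e)γ} = Z_{(0, ed mod N)}`.
[folklore] -/
theorem eisensteinOneDiv_vecMul_of_mem_gamma0 [NeZero N] {γ : SL(2, ℤ)} (hγ : γ ∈ Gamma0 N)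
    (e : ZMod N) (τ : ℍ) :
    eisensteinOneDiv N (![0, (e.val : ℤ)] ᵥ* (γ : Matrix (Fin 2) (Fin 2) ℤ)) τ =
      eisensteinOneDiv N ![0, ((e * ((γ 1 1 : ℤ) : ZMod N)).val : ℤ)] τ := by
  have hc : (((γ 1 0 : ℤ) : ZMod N)) = 0 := by
    have h := hγ
    rw [Gamma0_mem] at h
    exact_mod_cast h
  refine eisensteinOneDiv_congr_mod (NeZero.ne N) (fun i ↦ ?_) τ
  fin_cases i
  · show (((![0, (e.val : ℤ)] ᵥ* (γ : Matrix (Fin 2) (Fin 2) ℤ)) 0 : ℤ) : ZMod N) =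
      ((![0, ((e * ((γ 1 1 : ℤ) : ZMod N)).val : ℤ)] 0 : ℤ) : ZMod N)
    rw [vecMul_fin_two₁]
    simp [hc]
  · show (((![0, (e.val : ℤ)] ᵥ* (γ : Matrix (Fin 2) (Fin 2) ℤ)) 1 : ℤ) : ZMod N) =
      ((![0, ((e * ((γ 1 1 : ℤ) : ZMod N)).val : ℤ)] 1 : ℤ) : ZMod N)
    rw [vecMul_fin_two₁]
    simp

/-- **`T_χ ∣₁ γ = χ(d) T_χ` for `γ = (a b; c d) ∈ Γ₀(N)`**: the combination
`T_χ = ∑_e χ̄(e) Z_{(0,e)}` has nebentypus `χ` (`Z_{(0,e)} ∣₁ γ = Z_{(0,e)γ} = Z_{(0,ed)}` and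
`χ̄(e) = χ(d) χ̄(ed)`). [cite: DiamondShurman2005, §4.8 (weight-1 Eisenstein series with
character)] -/
theorem eisensteinOneDivChar_slash_of_mem_gamma0 [NeZero N] (χ : DirichletCharacter ℂ N)
    {γ : SL(2, ℤ)} (hγ : γ ∈ Gamma0 N) :
    (eisensteinOneDivChar χ) ∣[(1 : ℤ)] γ =
      χ ((γ 1 1 : ℤ) : ZMod N) • eisensteinOneDivChar χ := by
  classical
  -- `d` is a unit mod `N`
  have hdet : (γ 0 0 : ℤ) * γ 1 1 - γ 0 1 * γ 1 0 = 1 := by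
    have := Matrix.SpecialLinearGroup.det_coe γ
    rw [Matrix.det_fin_two] at this
    exact this
  have hc : (((γ 1 0 : ℤ) : ZMod N)) = 0 := by
    have h := hγ
    rw [Gamma0_mem] at h
    exact_mod_cast h
  have hd1 : ((γ 0 0 : ℤ) : ZMod N) * ((γ 1 1 : ℤ) : ZMod N) = 1 := by
    have := congrArg ((↑) : ℤ → ZMod N) hdet
    push_cast at this
    rw [hc, mul_zero, sub_zero] at this
    exact this
  have hu : IsUnit (((γ 1 1 : ℤ) : ZMod N)) := IsUnit.of_mul_eq_one_right _ hd1
  set u : (ZMod N)ˣ := hu.unit with hu_def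
  have huval : (u : ZMod N) = ((γ 1 1 : ℤ) : ZMod N) := hu.unit_spec
  funext τ
  simp only [ModularForm.SL_slash_apply, eisensteinOneDivChar, Pi.smul_apply, smul_eq_mul,
    Finset.sum_mul, Finset.mul_sum]
  -- each term: `χ̄(e) Z_{(0,e)}(γτ) (cτ+d)^{-1} = χ̄(e) Z_{(0, e d)}(τ)`
  have hterm : ∀ e : ZMod N, χ⁻¹ e * eisensteinOneDiv N ![0, (e.val : ℤ)] (γ • τ) *
      denom γ τ ^ (-(1 : ℤ)) = χ⁻¹ e * eisensteinOneDiv N ![0, ((e * u).val : ℤ)] τ := by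
    intro e
    have h := congr_fun (eisensteinOneDiv_slash N ![0, (e.val : ℤ)] γ) τ
    rw [ModularForm.SL_slash_apply, eisensteinOneDiv_vecMul_of_mem_gamma0 hγ, ← huval] at h
    rw [mul_assoc, h]
  simp_rw [hterm]
  have hχd : χ ((γ 1 1 : ℤ) : ZMod N) ≠ 0 := by
    intro h0
    have := congrArg χ hd1
    rw [map_mul, map_one, h0, mul_zero] at this
    exact zero_ne_one this
  -- reindex `e ↦ e u` on the right
  symm
  calc ∑ e : ZMod N, χ ((γ 1 1 : ℤ) : ZMod N) * (χ⁻¹ e * eisensteinOneDiv N ![0, (e.val : ℤ)] τ)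
      = ∑ e : ZMod N, χ ((γ 1 1 : ℤ) : ZMod N) *
          (χ⁻¹ (e * u) * eisensteinOneDiv N ![0, ((e * u).val : ℤ)] τ) :=
        (Fintype.sum_equiv (Units.mulRight u)
          (fun e ↦ χ ((γ 1 1 : ℤ) : ZMod N) *
            (χ⁻¹ (e * u) * eisensteinOneDiv N ![0, ((e * u).val : ℤ)] τ))
          (fun e ↦ χ ((γ 1 1 : ℤ) : ZMod N) * (χ⁻¹ e * eisensteinOneDiv N ![0, (e.val : ℤ)] τ))
          (fun e ↦ rfl)).symm
    _ = ∑ e : ZMod N, χ⁻¹ e * eisensteinOneDiv N ![0, ((e * u).val : ℤ)] τ := by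
        refine Finset.sum_congr rfl fun e _ ↦ ?_
        rw [map_mul, MulChar.inv_apply_eq_inv' χ (u : ZMod N), huval]
        field_simp

end Literature.NumberTheory.EllipticCurves.ModularForms
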